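import Literature.NumberTheory.LFunctions.Zhang2022.KnifeEdgeLambdaBlock
import Literature.NumberTheory.LFunctions.Zhang2022.KnifeEdgeOffDiagForm
import Literature.NumberTheory.LFunctions.Zhang2022.Section5Lemma57

/-!
# Zhang (2022), rung F-S3 (Landau–Siegel programme, family B-len, stratum S1-Λ): the Λ-OVERHANG design —
# the Λ-piece BEYOND the wall (`top = θ > 1`, profile supported on `[1,θ]`), the diagonal functional
# `K_Λ^{>1}` as an explicit integral (row len-E5 = E-070), the dictionary statement over the overhang class and
# the `C`-bounded cross slot with the required-strength price in kernel form (row len-E6 = E-071)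

Y. Zhang, *Discrete mean estimates and the Landau–Siegel zero*, arXiv:2211.02515v1 [Zhang2022LandauSiegel] —
an unrefereed manuscript under adjudication. **WHAT THIS IS NOT: not a claim about Theorems 1–2 of
arXiv:2211.02515, about Landau–Siegel zeros, or about Parity. The programme SEARCHES and TYPES; nothing here
asserts any estimate: `ELambdaOverhang`, `ELambdaOverhangCloses`, `LambdaOverhangCS`, `LambdaOverhangDiagNonneg`,
`LambdaCrossBounded`, `LambdaCrossForm` are bare `Prop`s / predicates (cell `obj/EDREGISTRY.md` rows E-070
«E-len-main(Λ,θ)» — status derivation (in-house, UNREVIEWED; HEURISTIC mechanism) — and E-071 «E-len-offdiag(Λ,θ)» —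
status OPEN IN PRINT; family list `B-len/EDLIST.md` v1 rows len-E5/len-E6, definition request D-len-2), and every
`theorem` is 2×2 Hermitian-form algebra about them or an implication into the named nodes of `SkeletonPropositions`.**

**Vocabulary of record = `KnifeEdgeLambdaBlock` (B-multi's row E-030, the IN-LENGTH Λ-piece, `top ≤ 1`):** the
Λ-type piece `LambdaPiece = ⟨k, top, prof⟩` (coefficients `χψ(n)·Λ^{⋆k}(n)/log^kP·prof(log n/log P)`, `n < P^{top}`),
its polynomial `lambdaPoly`, the realised two-piece value table `lambdaDesign χ u L c Λ_s = H_u + c·Λ_s^{−1/2}·H_λ`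
(in-class `χψ`-piece `u` of length `P`, BALANCED amplitude `c` at a balancing scale `Λ_s : BandScale`), the block
pencil `lambdaBlockMainTerm K X u u′ L c = 𝔅(u) + 2Re(κ_×(u,λ)·c) + |c|²K_Λ(λ)` PARAMETRIC in the diagonal functional
`K : LambdaDiag` and the cross functional `X : LambdaCross`, and the proved block algebra
(`sq_sqrt_sub_le_lambdaBlockMainTerm`, `lambdaBlockMainTerm_neg_of_indefinite`). This file is the same object with
the Λ-piece moved BEYOND THE WALL: `LambdaPiece.Overhang θ L v′` («`top = θ > 1`, `k ≥ 1`, profile continuous on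
`[1,θ]` with a marked `L²` right derivative `v′`, ZERO below the wall, bounded; NO continuity at the wall and NO
top-vanishing» — the Montgomery–Vaughan taper `P₁(z) = max((θ−z)/(θ−1), 0)·𝟙_{z ≥ 1}`, `P₁(1⁺) = 1`, is in the class:
`overhang_mvTaperPiece`; the smooth top-vanishing `χψ`-class `OverhangPiece` is the wrong class for Λ-coefficients).
Units: the Λ×Λ diagonal is `χ`-FREE and carries NO factor `𝔞` while `𝔅(u)` does («at equal mass `K_Λ : 𝔅(u) ≍ 1 : 𝔞`»,
cell mechanism of ls-theory 2026-08-26 Q1(i)); the balancing scale `Λ_s` of `lambdaDesign` is where this is booked —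
the natural reading is `Λ_s = invFrakAScale = 𝔞⁻¹` (then a `χ`-free diagonal and a one-dipole cross, Q1(ii), are
exactly constant `K`, `κ_×` in units of `𝔞𝔓`); the statement keeps `Λ_s` a parameter as E-030 does.

**Row len-E5 / E-070 (Part 2).** `lambdaOverhangDiag θ w : LambdaDiag`, `L ↦ ∫₁^θ w(z)‖prof(z)‖² dz` — the diagonal
of the Λ-overhang as an explicit integral with the WEIGHT `w` the derivation fixes (PNT rule
`Σ_q Λ(q)q^{β−1}G(z_q)/log P = ∫G(z)e^{β log P·z}dz + …` in place of the dipole rule inside formula I's residue-weight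
skeleton, Q1(iii); for the plain diagonal `Σ_{P<n≤P^θ}Λ(n)²|v(z_n)|²/(n log²P)` the prime number theorem gives
`w(z) = z`), `≥ 0` for `w ≥ 0` (`lambdaOverhangDiag_nonneg`, the row's «sign +» as the predicate
`LambdaOverhangDiagNonneg`). The IN-LENGTH part of `K_Λ` is E-030's and is cited, not re-derived.

**The dictionary (Part 3) = rows E-070 ⊕ E-071 as ONE statement shape, `ELambdaOverhang c' θ K X Λ_s`:** under (A),
for every in-class kinked `u` (`u(1) = 0`), every Λ-piece `L` overhanging to `θ`, every amplitude `c`, eventually in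
`D`: `|discMean(lambdaDesign χ u L c Λ_s) − (𝔅(u) + 2Re(κ_×c) + |c|²K_Λ(L))·𝔞𝔓| ≤ ε𝔞𝔓` — verbatim the shape of
`EMultiLambda` with `L.Admissible` (`top ≤ 1`) replaced by `L.Overhang θ v′` (`top = θ > 1`). Decision statement
`ELambdaOverhangCloses θ K X`, (B1) claim `LambdaOverhangCS θ K X`; PROVED: `not_eLambdaOverhangCloses_of_cs` (CS +
`K ≥ 0` ⇒ never closes), `eLambdaOverhangCloses_of_indefinite` (`𝔅(u)K < |κ_×|²`, `K > 0` ⇒ closes at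
`c = −κ̄_×/K`), `not_eLambdaOverhangCloses_zero` (**«NO by itself»: with `X = 0` no Λ-overhang design closes — len-E6
is the only live entry**), and the POS endgame `theorem1_of_eLambdaOverhang : ELambdaOverhang → ELambdaOverhangCloses →
Prop22i → Lemma23 c' → Theorem1` (via `eventually_not_assumptionA_of_negative_mainTerm_family`).

**Row len-E6 / E-071 (Part 4; OPEN IN PRINT — nearest results: Drappeau–Pratt–Radziwiłł, primes against Dirichlet
characters averaged over ALL moduli with Fourier support `2 + 50/1093` (`OneLevelDensity.drappeauPrattRadziwill2023_theorem1`),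
Basak's thin windows of moduli (`basak2025_theorem11/12`), and the Barban–Davenport–Halberstam / Montgomery–Hooley
variance asymptotic (all `q ≤ Q`, `Q ≥ N(log N)^{−A}`); NOTHING for prime moduli `p ∼ P` at length `P^θ`, `θ > 1`,
where the multiplicative large sieve gives only the trivial scale `(N + P²)‖a‖²`).** `LambdaCrossBounded θ C X`:
`|κ_×(u,L)| ≤ C·N₁(u)·N_θ(prof)` on the class, in the `H¹`-sizes `inClassNorm` / `overhangNorm` of
`KnifeEdgeOffDiagForm`; PROVED the REQUIRED-STRENGTH price in kernel form: a design `d = (u, L)` with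
`(C·N₁N_θ)² ≤ 𝔅(u)·K(L)` never closes against a `C`-bounded cross (`lambdaBlockMainTerm_nonneg_of_strength`,
`not_closes_of_crossBounded`), i.e. **`Creq_offdiag(d) = √(𝔅(u)K(L))/(N₁(u)N_θ(L))`** (and it is attained: a cross
of size `> √(𝔅(u)K(L))` closes, `eLambdaOverhangCloses_of_indefinite`); the ROBUST currency `Cstar_offdiag` is `0` on
the whole class by quantifier order (`X = 0` is `C`-bounded, `lambdaCrossBounded_zero` + `not_eLambdaOverhangCloses_zero`).
The priced slot `LambdaCrossForm c' θ K Λ_s C := ∃ X, LambdaCrossBounded θ C X ∧ ELambdaOverhang c' θ K X Λ_s` («the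
Λ-overhang dictionary holds with SOME `C`-bounded cross functional») and `not_closes_of_lambdaCrossForm` (the kernel
sentence a design would have to beat: with `C ≤ Creq(d)` no such world lets `d` close).

**Part 5 — non-vacuity:** `mvTaperPiece θ = ⟨1, θ, P₁⟩` is a Λ-piece overhanging to `θ` for every `θ > 1`.

**Part 6 — the `𝔞`-GRADED dictionary at FIXED amplitude (the planner's adopted generality, cell INBOX
2026-08-26T18:19:06Z; complements Part 3).** For crosses that are NOT one-dipole (`∝ √𝔞`) — a two-dipole part in
`𝔞`-units plus a dipole-FREE part, e.g. a rank-one DIAGONAL coupling of `u` and `v_Λ` through `u(0)` with no surviving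
`χ` (pairing shape (a) of the cell's Q→theory-len-3) — the balanced-amplitude shape of Part 3 cannot make the block
constant; the right statement is at FIXED amplitude `s` on `u` with an `𝔞`-graded cross `G : ℝ → LambdaCross`:
`gradedDesign = s·H_u + H_λ` (unscaled Λ-piece), `lambdaGradedMainTerm K G u u′ L s 𝔞 = ‖s‖²𝔅(u)·𝔞 + K(L) +
2Re(s·(G 𝔞)(u,L))` (units of `𝔓`), `ELambdaOverhangGraded c' θ K G` (dictionary, NOT asserted), closing AT A FLOOR
`LambdaGradedClosesAtFloor K G a u u′ L := ∃ s, ∃ η > 0, ∀ 𝔞 ≥ a, M(s,𝔞) ≤ −η𝔞` (what positivity needs when `𝔞`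
is known only above the Lemma 5.7 floor `a₀ = 3/(2e²π²)`: `aZero`, `frakA_floor` from `Lemma57.frakA_ge'`), and
PROVED: the general graded positivity endgame `eventually_not_assumptionA_of_le`, `theorem1_of_eLambdaOverhangGraded`
(+ `_aZero`, Theorem 2), `not_lambdaGradedClosesAtFloor_of_zero` («NO by itself» again: `G = 0`, `K ≥ 0`),
`lambdaGradedClosesAtFloor_of_affine` (affine grading `G 𝔞 = 𝔞•X₁ + X₀`: closes at floor `a > 0` as soon as
`q₁(s) < 0 ∧ q₁(s)·a + q₀(s) < 0`, `q₁ = ‖s‖²𝔅(u) + 2Re(sX₁(u,L))`, `q₀ = K(L) + 2Re(sX₀(u,L))`),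
`gradedCoeffOne_ge` (the kernel half of `Creq` in this currency: `|X₁(u,L)| ≤ m`, `𝔅(u) > 0` ⇒ `q₁(s) ≥ −m²/𝔅(u)`),
and `not_lambdaGradedClosesAtFloor_of_sqrt` (a ONE-DIPOLE cross `G 𝔞 = √𝔞•X` NEVER closes at fixed amplitude on a
design with `𝔅(u) > 0`, `K ≥ 0` — which is exactly why Part 3 balances the amplitude). **Part 7** —
`lambdaOverhangDiagH1 θ w₀ w₁` = `∫₁^θ (w₀‖prof‖² + w₁‖prof′‖²)`, the `H¹`-weighted diagonal the planner asked for
(`prof′ = deriv prof`, the marked derivative a.e. for piecewise-`C¹` profiles), `≥ 0` for `w₀, w₁ ≥ 0`.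

References: Zhang, arXiv:2211.02515v1, §2 p. 6, (2.15)–(2.20), (2.27), (2.31), Lemma 2.3, Prop. 2.2 (i); §7 Prop 7.1,
(7.2) p.44; §8 (8.3), (8.23), Lemma 8.1 [cite: Zhang2022LandauSiegel, §7 Prop 7.1 (7.2); §8 Lemma 8.1]; the
transplant model S. Feng (2012) [Feng2012CriticalLine, (1.11)]; nearest print S. Drappeau, K. Pratt, M. Radziwiłł (2023)
[DrappeauPrattRadziwill2023, Theorem 1].
«The programme SEARCHES and TYPES; no claim about Landau–Siegel zeros, Theorems 1–2 of arXiv:2211.02515 or a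
repaired Margin232 until a kernel theorem says so.»
-/

noncomputable section

open Complex Real Set intervalIntegral
open _root_.MeasureTheory

namespace Literature.NumberTheory.LFunctions.Zhang2022

namespace KnifeEdge

open Repair Skeleton

/-! ### Part 1 — the Λ-piece BEYOND the wall -/

/-- **Overhang admissibility of a Λ-piece** (stratum S1-Λ of B-len): convolution order `k ≥ 1`, logarithmic top
`top = θ > 1`, profile continuous on `[1,θ]` with a marked right derivative `v′ ∈ L²(1,θ)` on `(1,θ)` (so that the
`H¹`-size `overhangNorm θ prof v′` is an honest integral), ZERO below the wall, bounded. No continuity at the wall,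
no vanishing at the top. (E-030's `LambdaPiece.Admissible` is the in-length case `top ≤ 1`.)
[cite: Zhang2022LandauSiegel, §7 (7.2) p.44] -/
structure LambdaPiece.Overhang (θ : ℝ) (L : LambdaPiece) (v' : ℝ → ℂ) : Prop where
  order : 1 ≤ L.k
  top_eq : L.top = θ
  one_lt : 1 < θ
  cont : ContinuousOn L.prof (Icc 1 θ)
  hasDeriv : ∀ x ∈ Ioo (1:ℝ) θ, HasDerivWithinAt L.prof (v' x) (Ioi x) x
  memLp : MemLp v' 2 (volume.restrict (Ioc 1 θ))
  vanish : ∀ y, y < 1 → L.prof y = 0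
  vanish' : ∀ y, y < 1 → v' y = 0
  bdd : ∃ B : ℝ, ∀ z, ‖L.prof z‖ ≤ B

/-- The balancing scale `Λ_s(D,χ) = 𝔞(χ)⁻¹` — the reading under which a `χ`-free (hence `𝔞`-free) Λ×Λ diagonal and
a one-dipole cross become constant `K`, `κ_×` in units of `𝔞𝔓` (cell mechanism Q1(i)–(ii), HEURISTIC; `𝔞 ≥ a₀ > 0`
under (A): `Skeleton.frakALowerBound_holds`). [cite: Zhang2022LandauSiegel, §2 (2.27), (2.31)] -/
def invFrakAScale : BandScale := fun D χ =>
  if h : D = 0 then 0 else by haveI : NeZero D := ⟨h⟩; exact (frakA χ)⁻¹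

/-! ### Part 2 — row len-E5 / E-070: the diagonal of the Λ-overhang as an explicit integral -/

/-- **`K_w(L) = ∫₁^θ w(z)‖prof(z)‖² dz` — the χ-FREE diagonal functional of the Λ-overhang** with the weight `w`
the derivation fixes (plain diagonal `Σ_{P<n≤P^θ}Λ(n)²|prof(z_n)|²/(n log²P)`: `w(z) = z` by the prime number theorem;
the formula-I-units weight is the derivation item of rows E-070 / E-030, cell mechanism of 2026-08-26, HEURISTIC).
No factor `𝔞` of its own — booked through the balancing scale. [cite: Zhang2022LandauSiegel, §7 Prop 7.1 (7.2) p.44] -/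
def lambdaOverhangDiag (θ : ℝ) (w : ℝ → ℝ) : LambdaDiag := fun L => ∫ z in (1:ℝ)..θ, w z * ‖L.prof z‖ ^ 2

/-- Unfolding lemma. [cite: Zhang2022LandauSiegel, §7 (7.2) p.44] -/
theorem lambdaOverhangDiag_apply (θ : ℝ) (w : ℝ → ℝ) (L : LambdaPiece) :
    lambdaOverhangDiag θ w L = ∫ z in (1:ℝ)..θ, w z * ‖L.prof z‖ ^ 2 := rfl

/-- **sign `+`**: for a non-negative weight on `[1,θ]`, `θ ≥ 1`, the diagonal functional is `≥ 0` (main term of a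
sum of `|·|²`). [cite: Zhang2022LandauSiegel, §7 Prop 7.1 (7.2) p.44] -/
theorem lambdaOverhangDiag_nonneg {θ : ℝ} (hθ : 1 ≤ θ) {w : ℝ → ℝ} (hw : ∀ z ∈ Icc 1 θ, 0 ≤ w z)
    (L : LambdaPiece) : 0 ≤ lambdaOverhangDiag θ w L :=
  intervalIntegral.integral_nonneg hθ fun z hz => mul_nonneg (hw z hz) (sq_nonneg _)

/-- **Claim «sign +» over the overhang class** (the analogue of E-030's `LambdaDiagNonneg`): `K ≥ 0` on every Λ-piece
overhanging to `θ`. [cite: Zhang2022LandauSiegel, §7 Prop 7.1 (7.2) p.44] -/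
def LambdaOverhangDiagNonneg (θ : ℝ) (K : LambdaDiag) : Prop :=
  ∀ (L : LambdaPiece) (v' : ℝ → ℂ), L.Overhang θ v' → 0 ≤ K L

/-- the explicit-integral candidate with a non-negative weight satisfies the sign claim.
[cite: Zhang2022LandauSiegel, §7 Prop 7.1 (7.2) p.44] -/
theorem lambdaOverhangDiagNonneg_of_weight {θ : ℝ} {w : ℝ → ℝ} (hw : ∀ z ∈ Icc 1 θ, 0 ≤ w z) :
    LambdaOverhangDiagNonneg θ (lambdaOverhangDiag θ w) :=
  fun L _ hL => lambdaOverhangDiag_nonneg hL.one_lt.le hw L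

/-- the plain-PNT weight `w(z) = z` is admissible. [cite: Zhang2022LandauSiegel, §7 (7.2) p.44] -/
theorem lambdaOverhangDiagNonneg_id {θ : ℝ} : LambdaOverhangDiagNonneg θ (lambdaOverhangDiag θ fun z => z) :=
  lambdaOverhangDiagNonneg_of_weight fun _ hz => zero_le_one.trans hz.1

/-! ### Part 3 — the dictionary over the overhang class (rows E-070 ⊕ E-071 as one shape; bare `Prop`s) -/

/-- **THE Λ-OVERHANG DICTIONARY, parametric in `(K_Λ, κ_×, Λ_s)`** (rows E-070 ⊕ E-071; E-070's diagonal is a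
derivation target — in-house, unreviewed, HEURISTIC mechanism; E-071's cross is OPEN IN PRINT; NOT asserted): under
(A), for every in-class kinked piece `u` (`u(1) = 0`), every Λ-piece `L` overhanging to `θ`, every amplitude `c` and
every `ε > 0`, for all large `D` and every primitive quadratic `χ (mod D)`:
`|discMean(H_u + cΛ_s(D,χ)^{−1/2}H_λ) − (𝔅(u) + 2Re(κ_×(u,λ)c) + |c|²K_Λ(λ))·𝔞𝔓| ≤ ε·𝔞𝔓` — the shape of
`EMultiLambda` (E-030) with the in-length admissibility replaced by `LambdaPiece.Overhang θ`.
[cite: Zhang2022LandauSiegel, §7 Prop 7.1 (7.2); §8 (8.3), (8.23), Lemma 8.1] -/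
def ELambdaOverhang (c' θ : ℝ) (K : LambdaDiag) (X : LambdaCross) (Λs : BandScale) : Prop :=
  ∀ (u u' : ℝ → ℂ), KinkedProfile u u' → u 1 = 0 → ∀ (L : LambdaPiece) (v' : ℝ → ℂ), L.Overhang θ v' →
    ∀ (c : ℂ) (ε : ℝ), 0 < ε → ForAllLarge fun D _ χ => AssumptionA D χ →
      |discMean c' χ (lambdaDesign χ u L c (Λs D χ)) - lambdaBlockMainTerm K X u u' L c * frakA χ * frakP D|
        ≤ ε * frakA χ * frakP D

/-- **E-070/071 CLOSES — the decision statement** (the S1-Λ «candidate» word in the POS currency): some realised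
Λ-overhang design has a NEGATIVE block value. [cite: Zhang2022LandauSiegel, §7 Prop 7.1 (7.2)] -/
def ELambdaOverhangCloses (θ : ℝ) (K : LambdaDiag) (X : LambdaCross) : Prop :=
  ∃ (u u' : ℝ → ℂ) (L : LambdaPiece) (v' : ℝ → ℂ) (c : ℂ),
    KinkedProfile u u' ∧ u 1 = 0 ∧ L.Overhang θ v' ∧ lambdaBlockMainTerm K X u u' L c < 0

/-- **Claim (B1) over the overhang class:** the cross is Cauchy–Schwarz-subordinate, `|κ_×(u,λ)|² ≤ 𝔅(u)·K_Λ(λ)`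
(under Lemma 2.3 / `ω > 0` the true form over any coefficient class is a sum of `|·|²`; prediction B-AH).
[cite: Zhang2022LandauSiegel, §2 Lemma 2.3, (2.15)] -/
def LambdaOverhangCS (θ : ℝ) (K : LambdaDiag) (X : LambdaCross) : Prop :=
  ∀ (u u' : ℝ → ℂ) (L : LambdaPiece) (v' : ℝ → ℂ), KinkedProfile u u' → u 1 = 0 → L.Overhang θ v' →
    ‖X u u' L‖ ^ 2 ≤ mainTermForm u u' * K L

section Certificate

variable {θ : ℝ} {K : LambdaDiag} {X : LambdaCross}

/-- **(B1) bookkeeping — the registry's «no» word:** with `K ≥ 0` and a CS-subordinate cross on the overhang class,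
the row never closes (block value `≥ (√𝔅(u) − |c|√K)² ≥ 0`, `sq_sqrt_sub_le_lambdaBlockMainTerm`).
[cite: Zhang2022LandauSiegel, §2 Lemma 2.3, (2.15)] -/
theorem not_eLambdaOverhangCloses_of_cs (hK : LambdaOverhangDiagNonneg θ K) (hX : LambdaOverhangCS θ K X) :
    ¬ ELambdaOverhangCloses θ K X := by
  rintro ⟨u, u', L, v', c, hu, hu1, hL, hneg⟩
  have hB : 0 ≤ mainTermForm u u' := mainTermForm_nonneg_of_isH1 hu.isH1
  have h := sq_sqrt_sub_le_lambdaBlockMainTerm hB (hK L v' hL) (hX u u' L v' hu hu1 hL) c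
  exact not_lt.2 ((sq_nonneg _).trans h) hneg

/-- **Indefinite ⇒ closes:** a design of the class with `𝔅(u)·K(L) < |κ_×(u,L)|²` and `K(L) > 0` closes, at the
amplitude `c = −κ̄_×/K` (`lambdaBlockMainTerm_neg_of_indefinite`). [cite: Zhang2022LandauSiegel, §7 Prop 7.1 (7.2)] -/
theorem eLambdaOverhangCloses_of_indefinite {u u' : ℝ → ℂ} {L : LambdaPiece} {v' : ℝ → ℂ}
    (hu : KinkedProfile u u') (hu1 : u 1 = 0) (hL : L.Overhang θ v') (hK : 0 < K L)
    (h : mainTermForm u u' * K L < ‖X u u' L‖ ^ 2) : ELambdaOverhangCloses θ K X :=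
  ⟨u, u', L, v', _, hu, hu1, hL, lambdaBlockMainTerm_neg_of_indefinite hK h⟩

/-- **«NO by itself» (row len-E5): with NO cross input (`X = 0`) no Λ-overhang design closes** when `K ≥ 0` on the
class — the block value is `𝔅(u) + |c|²K(L) ≥ 0`; so len-E6 is the only live entry of the class, and since the input
`0` is `C`-bounded for every `C ≥ 0` (`lambdaCrossBounded_zero`) the robust currency `Cstar_offdiag` vanishes on the
whole Λ class by quantifier order. [cite: Zhang2022LandauSiegel, §7 Prop 7.1 (7.2) p.44] -/
theorem not_eLambdaOverhangCloses_zero (hK : LambdaOverhangDiagNonneg θ K) : ¬ ELambdaOverhangCloses θ K 0 := by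
  refine not_eLambdaOverhangCloses_of_cs hK fun u u' L v' hu _ hL => ?_
  simpa using mul_nonneg (mainTermForm_nonneg_of_isH1 hu.isH1) (hK L v' hL)

end Certificate

section Endgame

variable {c' θ : ℝ} {K : LambdaDiag} {X : LambdaCross} {Λs : BandScale}

/-- **B-len's S1-Λ POS endgame as a kernel implication: the Λ-overhang dictionary + its closing + Zhang's Part-1
zero model ⇒ Theorem 1 of the manuscript** (family positivity endgame
`eventually_not_assumptionA_of_negative_mainTerm_family` + `Skeleton.theorem1_of_eventually_not_assumptionA`). Both
`E` hypotheses are OPEN / underived (rows E-070, E-071; prediction B-AH: the closing fails,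
`not_eLambdaOverhangCloses_of_cs`); `Prop22i`, `Lemma23 c'` are CLAIMS of the manuscript — nothing is asserted.
[cite: Zhang2022LandauSiegel, §2 p. 6, Lemma 2.3, Prop. 2.2 (i), §7 Prop 7.1 (7.2)] -/
theorem theorem1_of_eLambdaOverhang (hE : ELambdaOverhang c' θ K X Λs) (hC : ELambdaOverhangCloses θ K X)
    (h22 : Prop22i) (h23 : Lemma23 c') : Theorem1 := by
  obtain ⟨u, u', L, v', c, hu, hu1, hL, hneg⟩ := hC
  exact Skeleton.theorem1_of_eventually_not_assumptionA
    (eventually_not_assumptionA_of_negative_mainTerm_family hneg (hE u u' hu hu1 L v' hL c) h22 h23)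

/-- … and Theorem 2. [cite: Zhang2022LandauSiegel, §1 Theorem 2] -/
theorem theorem2_of_eLambdaOverhang (hE : ELambdaOverhang c' θ K X Λs) (hC : ELambdaOverhangCloses θ K X)
    (h22 : Prop22i) (h23 : Lemma23 c') : Theorem2 :=
  Skeleton.theorem2_of_theorem1 (theorem1_of_eLambdaOverhang hE hC h22 h23)

/-- **The edge-report route:** the dictionary with `K > 0` on the class and ONE design whose derived block is
INDEFINITE already gives Theorem 1 (to be priced first as a dictionary-consistency test, as for E-030).
[cite: Zhang2022LandauSiegel, §2 p. 6, §7 Prop 7.1 (7.2)] -/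
theorem theorem1_of_eLambdaOverhang_indefinite (hE : ELambdaOverhang c' θ K X Λs) {u u' : ℝ → ℂ}
    {L : LambdaPiece} {v' : ℝ → ℂ} (hu : KinkedProfile u u') (hu1 : u 1 = 0) (hL : L.Overhang θ v')
    (hK : 0 < K L) (hI : mainTermForm u u' * K L < ‖X u u' L‖ ^ 2) (h22 : Prop22i) (h23 : Lemma23 c') :
    Theorem1 :=
  theorem1_of_eLambdaOverhang hE (eLambdaOverhangCloses_of_indefinite hu hu1 hL hK hI) h22 h23

end Endgame

/-! ### Part 4 — row len-E6 / E-071: the `C`-bounded cross slot and the required-strength price (kernel form) -/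

section Cross

/-- **`C`-BOUNDED cross functional on the overhang class**: `|κ_×(u,L)| ≤ C·N₁(u)·N_θ(prof_L)` with the `H¹`-sizes
`N₁ = inClassNorm u u′`, `N_θ = overhangNorm θ prof v′` of `KnifeEdgeOffDiagForm` — the quantitative statement of row
E-071 through which a Λ-design is PRICED. Bare predicate, asserted for no `X`. [cite: Zhang2022LandauSiegel, §7 (7.2) p.44] -/
def LambdaCrossBounded (θ C : ℝ) (X : LambdaCross) : Prop :=
  ∀ (u u' : ℝ → ℂ) (L : LambdaPiece) (v' : ℝ → ℂ), KinkedProfile u u' → u 1 = 0 → L.Overhang θ v' →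
    ‖X u u' L‖ ≤ C * inClassNorm u u' * overhangNorm θ L.prof v'

variable {θ C : ℝ} {X : LambdaCross} {K : LambdaDiag}

/-- the zero cross is `C`-bounded for every `C ≥ 0`. [cite: Zhang2022LandauSiegel, §7 (7.2) p.44] -/
theorem lambdaCrossBounded_zero (hC : 0 ≤ C) : LambdaCrossBounded θ C 0 := fun u u' L v' _ _ _ => by
  simpa using mul_nonneg (mul_nonneg hC (inClassNorm_nonneg u u')) (overhangNorm_nonneg θ L.prof v')

/-- monotone in `C`. [cite: Zhang2022LandauSiegel, §7 (7.2) p.44] -/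
theorem LambdaCrossBounded.mono (h : LambdaCrossBounded θ C X) {C' : ℝ} (hle : C ≤ C') :
    LambdaCrossBounded θ C' X := fun u u' L v' hu hu1 hL => by
  refine (h u u' L v' hu hu1 hL).trans ?_
  rw [mul_assoc, mul_assoc]
  exact mul_le_mul_of_nonneg_right hle (mul_nonneg (inClassNorm_nonneg u u') (overhangNorm_nonneg θ L.prof v'))

/-- **THE REQUIRED-STRENGTH PRICE, kernel form (pointwise):** on a design with `𝔅(u) ≥ 0`, `K(L) ≥ 0`, a cross of
size `|κ_×(u,L)| ≤ m` with `m² ≤ 𝔅(u)·K(L)` leaves the block value `≥ 0` at EVERY amplitude — so closing the design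
needs a cross of size `> √(𝔅(u)K(L))`, and that size suffices (`eLambdaOverhangCloses_of_indefinite`, `K(L) > 0`).
[cite: Zhang2022LandauSiegel, §2 Lemma 2.3, (2.15); §7 Prop 7.1 (7.2)] -/
theorem lambdaBlockMainTerm_nonneg_of_strength {u u' : ℝ → ℂ} {L : LambdaPiece} {m : ℝ}
    (hB : 0 ≤ mainTermForm u u') (hK : 0 ≤ K L) (hm : ‖X u u' L‖ ≤ m)
    (hsq : m ^ 2 ≤ mainTermForm u u' * K L) (c : ℂ) : 0 ≤ lambdaBlockMainTerm K X u u' L c := by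
  have hcs : ‖X u u' L‖ ^ 2 ≤ mainTermForm u u' * K L :=
    (pow_le_pow_left₀ (norm_nonneg _) hm 2).trans hsq
  exact (sq_nonneg _).trans (sq_sqrt_sub_le_lambdaBlockMainTerm hB hK hcs c)

/-- **`Creq_offdiag(d) = √(𝔅(u)·K(L))/(N₁(u)·N_θ(L))` in kernel form:** against a `C`-bounded cross, a design of the
class with `(C·N₁N_θ)² ≤ 𝔅(u)·K(L)` (and `K(L) ≥ 0`) has block value `≥ 0` at every amplitude.
[cite: Zhang2022LandauSiegel, §2 Lemma 2.3, (2.15); §7 Prop 7.1 (7.2)] -/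
theorem not_closes_of_crossBounded (hX : LambdaCrossBounded θ C X) {u u' : ℝ → ℂ} {L : LambdaPiece}
    {v' : ℝ → ℂ} (hu : KinkedProfile u u') (hu1 : u 1 = 0) (hL : L.Overhang θ v') (hK : 0 ≤ K L)
    (hreq : (C * inClassNorm u u' * overhangNorm θ L.prof v') ^ 2 ≤ mainTermForm u u' * K L) (c : ℂ) :
    0 ≤ lambdaBlockMainTerm K X u u' L c :=
  lambdaBlockMainTerm_nonneg_of_strength (mainTermForm_nonneg_of_isH1 hu.isH1) hK (hX u u' L v' hu hu1 hL) hreq c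

variable (c')

/-- **E-len-offdiag(Λ,θ) PRICED — row len-E6 / E-071 (OPEN IN PRINT — nearest result [DrappeauPrattRadziwill2023,
Theorem 1] = `OneLevelDensity.drappeauPrattRadziwill2023_theorem1`: primes against Dirichlet characters averaged over
ALL moduli with Fourier support `2 + 50/1093`, a complete modulus average — not prime moduli `p ∼ P` at length
`P^θ`, `θ > 1`; NOT asserted).** The Λ-overhang dictionary holds with the diagonal `K`, the scale `Λ_s`, and SOME
cross functional that is `C`-bounded on the class. The existential is the honest content of the row («there is an
off-diagonal cross main term of at most this size»), not a construction. [cite: Zhang2022LandauSiegel, §7 Prop 7.1 (7.2) p.44; §8 (8.23)] -/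
def LambdaCrossForm (θ : ℝ) (K : LambdaDiag) (Λs : BandScale) (C : ℝ) : Prop :=
  ∃ X : LambdaCross, LambdaCrossBounded θ C X ∧ ELambdaOverhang c' θ K X Λs

variable {c'} {Λs : BandScale}

/-- priced E-071 is monotone in the level: a smaller bound is the stronger statement.
[cite: Zhang2022LandauSiegel, §7 (7.2) p.44] -/
theorem LambdaCrossForm.mono (h : LambdaCrossForm c' θ K Λs C) {C' : ℝ} (hle : C ≤ C') :
    LambdaCrossForm c' θ K Λs C' := by
  obtain ⟨X, hB, hE⟩ := h
  exact ⟨X, hB.mono hle, hE⟩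

/-- **The kernel sentence a Λ-design has to beat:** in ANY world of the priced slot at level `C`, a design with
`(C·N₁N_θ)² ≤ 𝔅(u)·K(L)` (i.e. `C ≤ Creq_offdiag(d)`) has a non-negative block value at every amplitude — it is
not the design that turns E-071 into `¬(A)`. The live per-design statement is `theorem1_of_eLambdaOverhang` /
`theorem1_of_eLambdaOverhang_indefinite` with a NAMED derived cross. [cite: Zhang2022LandauSiegel, §2 Lemma 2.3, (2.15); §7 Prop 7.1 (7.2)] -/
theorem not_closes_of_lambdaCrossForm (h : LambdaCrossForm c' θ K Λs C) {u u' : ℝ → ℂ} {L : LambdaPiece}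
    {v' : ℝ → ℂ} (hu : KinkedProfile u u') (hu1 : u 1 = 0) (hL : L.Overhang θ v') (hK : 0 ≤ K L)
    (hreq : (C * inClassNorm u u' * overhangNorm θ L.prof v') ^ 2 ≤ mainTermForm u u' * K L) :
    ∃ X : LambdaCross, LambdaCrossBounded θ C X ∧ ELambdaOverhang c' θ K X Λs
      ∧ ∀ c : ℂ, 0 ≤ lambdaBlockMainTerm K X u u' L c := by
  obtain ⟨X, hB, hE⟩ := h
  exact ⟨X, hB, hE, not_closes_of_crossBounded hB hu hu1 hL hK hreq⟩

end Cross

/-! ### Part 5 — non-vacuity of the class: the Montgomery–Vaughan taper beyond the wall -/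

section Taper

variable {θ : ℝ}

/-- the Montgomery–Vaughan taper `P₁(z) = max((θ − z)/(θ − 1), 0)` for `z ≥ 1`, zero below the wall — the first S1-Λ
shape (`P₁(1⁺) = 1`, `P₁ = 0` from `z = θ` on). [cite: Zhang2022LandauSiegel, §7 (7.2) p.44] -/
def mvTaper (θ : ℝ) (z : ℝ) : ℂ := if z < 1 then 0 else (((max ((θ - z) / (θ - 1)) 0 : ℝ)) : ℂ)

/-- its marked derivative `−1/(θ−1)` on `[1, ∞)` (used on `(1,θ)` only), zero below the wall.
[cite: Zhang2022LandauSiegel, §7 (7.2) p.44] -/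
def mvTaper' (θ : ℝ) (z : ℝ) : ℂ := if z < 1 then 0 else ((((-1) / (θ - 1) : ℝ)) : ℂ)

/-- the MV-taper Λ-piece `⟨k = 1, top = θ, P₁⟩` (primes with weight `Λ(n)/log P`). [cite: Zhang2022LandauSiegel, §7 (7.2) p.44] -/
def mvTaperPiece (θ : ℝ) : LambdaPiece := ⟨1, θ, mvTaper θ⟩

/-- `‖P₁(z)‖ ≤ 1` everywhere, for `θ > 1`. [cite: Zhang2022LandauSiegel, §7 (7.2) p.44] -/
theorem norm_mvTaper_le_one (hθ : 1 < θ) (z : ℝ) : ‖mvTaper θ z‖ ≤ 1 := by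
  unfold mvTaper
  split_ifs with hz
  · simp
  · rw [Complex.norm_real, Real.norm_eq_abs, abs_of_nonneg (le_max_right _ _)]
    refine max_le ?_ zero_le_one
    rw [div_le_one (by linarith)]
    linarith [not_lt.1 hz]

/-- **non-vacuity of the class: the MV taper is a Λ-piece overhanging to `θ`**, for every `θ > 1` (note
`P₁(1) = 1 ≠ 0`: it is not an `OverhangPiece` of the `χψ`-world). [cite: Zhang2022LandauSiegel, §7 (7.2) p.44] -/
theorem overhang_mvTaperPiece (hθ : 1 < θ) : (mvTaperPiece θ).Overhang θ (mvTaper' θ) where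
  order := le_rfl
  top_eq := rfl
  one_lt := hθ
  cont := by
    have hf : Continuous fun z : ℝ => ((((max ((θ - z) / (θ - 1)) 0 : ℝ)) : ℂ)) := by fun_prop
    refine hf.continuousOn.congr fun z hz => ?_
    simp [mvTaperPiece, mvTaper, not_lt.2 hz.1]
  hasDeriv := by
    intro x hx
    have hd : HasDerivAt (fun z : ℝ => ((((θ - z) / (θ - 1) : ℝ)) : ℂ)) ((((-1) / (θ - 1) : ℝ)) : ℂ) x := by
      have h1 : HasDerivAt (fun z : ℝ => (θ - z) / (θ - 1)) ((-1) / (θ - 1)) x := by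
        simpa using ((hasDerivAt_id x).const_sub θ).div_const (θ - 1)
      exact h1.ofReal_comp
    have heq : ∀ᶠ z in nhds x, (mvTaperPiece θ).prof z = ((((θ - z) / (θ - 1) : ℝ)) : ℂ) := by
      filter_upwards [Ioo_mem_nhds hx.1 hx.2] with z hz
      have hq : 0 ≤ (θ - z) / (θ - 1) := div_nonneg (by linarith [hz.2]) (by linarith)
      simp [mvTaperPiece, mvTaper, not_lt.2 hz.1.le, max_eq_left hq]
    have := (hd.congr_of_eventuallyEq heq).hasDerivWithinAt (s := Ioi x)
    simpa [mvTaper', not_lt.2 hx.1.le] using this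
  memLp := by
    have hc : Continuous fun _ : ℝ => ((((-1) / (θ - 1) : ℝ)) : ℂ) := continuous_const
    have hmem : MemLp (fun _ : ℝ => ((((-1) / (θ - 1) : ℝ)) : ℂ)) 2 (volume.restrict (Ioc 1 θ)) :=
      MemLp.of_bound hc.aestronglyMeasurable ‖((((-1) / (θ - 1) : ℝ)) : ℂ)‖
        (Filter.Eventually.of_forall fun _ => le_rfl)
    refine hmem.ae_eq ?_
    filter_upwards [ae_restrict_mem measurableSet_Ioc] with z hz
    simp [mvTaper', not_lt.2 hz.1.le]
  vanish := fun y hy => by simp [mvTaperPiece, mvTaper, hy]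
  vanish' := fun y hy => by simp [mvTaper', hy]
  bdd := ⟨1, norm_mvTaper_le_one hθ⟩

end Taper

/-! ### Part 6 — the `𝔞`-GRADED dictionary at FIXED amplitude and its endgame at the `𝔞`-floor (proved) -/

section Graded

variable {D : ℕ} (χ : DirichletCharacter ℂ D)

/-- **The fixed-amplitude design** `s·H_u + H_λ` (in-class piece with amplitude `s`, UNSCALED Λ-piece) as a value table.
[cite: Zhang2022LandauSiegel, §2 (2.27), §7 (7.2)] -/
def gradedDesign (u : ℝ → ℂ) (L : LambdaPiece) (s : ℂ) : Chr D → ℂ → ℂ := fun x t =>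
  profPoly χ x (fun z => s * u z) ⌈bigP D⌉₊ t + lambdaPoly χ x L t

variable {χ}

/-- **The `𝔞`-graded would-be main constant at fixed amplitude** (units of `𝔓`):
`M(s,𝔞) = ‖s‖²𝔅(u)·𝔞 + K(L) + 2Re(s·(G 𝔞)(u,L))` — `K` the `𝔞`-free Λ×Λ diagonal (row E-070), `G : ℝ → LambdaCross`
the `𝔞`-GRADED cross (row E-071; `𝔞 ↦ κ_𝔞`). [cite: Zhang2022LandauSiegel, §7 Prop 7.1 (7.2) p.44, (2.31)] -/
def lambdaGradedMainTerm (K : LambdaDiag) (G : ℝ → LambdaCross) (u u' : ℝ → ℂ) (L : LambdaPiece) (s : ℂ)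
    (𝔞 : ℝ) : ℝ :=
  ‖s‖ ^ 2 * mainTermForm u u' * 𝔞 + K L + 2 * (s * G 𝔞 u u' L).re

/-- the affine grading `G 𝔞 = 𝔞•X₁ + X₀` (two-dipole part `X₁` in `𝔞`-units, dipole-free part `X₀`).
[cite: Zhang2022LandauSiegel, §7 (7.2) p.44, (2.31)] -/
def affineCross (X₁ X₀ : LambdaCross) : ℝ → LambdaCross := fun 𝔞 u u' L => (𝔞 : ℂ) * X₁ u u' L + X₀ u u' L

/-- the one-dipole grading `G 𝔞 = √𝔞•X` (cross `∝ L′(1,χ)`; the law Part 3 balances the amplitude against).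
[cite: Zhang2022LandauSiegel, §7 (7.2) p.44, (2.31)] -/
def sqrtCross (X : LambdaCross) : ℝ → LambdaCross := fun 𝔞 u u' L => ((Real.sqrt 𝔞 : ℝ) : ℂ) * X u u' L

/-- `q₁(s) = ‖s‖²𝔅(u) + 2Re(s·X₁(u,L))`, the `𝔞`-coefficient of the affine main term. [cite: Zhang2022LandauSiegel, §7 (7.2) p.44] -/
def gradedCoeffOne (X₁ : LambdaCross) (u u' : ℝ → ℂ) (L : LambdaPiece) (s : ℂ) : ℝ :=
  ‖s‖ ^ 2 * mainTermForm u u' + 2 * (s * X₁ u u' L).re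

/-- `q₀(s) = K(L) + 2Re(s·X₀(u,L))`, the `𝔞`-free coefficient of the affine main term. [cite: Zhang2022LandauSiegel, §7 (7.2) p.44] -/
def gradedCoeffZero (K : LambdaDiag) (X₀ : LambdaCross) (u u' : ℝ → ℂ) (L : LambdaPiece) (s : ℂ) : ℝ :=
  K L + 2 * (s * X₀ u u' L).re

/-- `M(s,𝔞) = q₁(s)·𝔞 + q₀(s)` for the affine grading. [cite: Zhang2022LandauSiegel, §7 (7.2) p.44] -/
theorem lambdaGradedMainTerm_affine (K : LambdaDiag) (X₁ X₀ : LambdaCross) (u u' : ℝ → ℂ) (L : LambdaPiece)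
    (s : ℂ) (𝔞 : ℝ) : lambdaGradedMainTerm K (affineCross X₁ X₀) u u' L s 𝔞
      = gradedCoeffOne X₁ u u' L s * 𝔞 + gradedCoeffZero K X₀ u u' L s := by
  simp only [lambdaGradedMainTerm, affineCross, gradedCoeffOne, gradedCoeffZero, mul_add, Complex.add_re]
  have : (s * ((𝔞 : ℂ) * X₁ u u' L)).re = 𝔞 * (s * X₁ u u' L).re := by
    rw [mul_left_comm, Complex.re_ofReal_mul]
  rw [this]
  ring

/-- `M(s,𝔞) = ‖s‖²𝔅(u)𝔞 + K(L) + 2Re(s·X(u,L))·√𝔞` for the one-dipole grading. [cite: Zhang2022LandauSiegel, §7 (7.2) p.44] -/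
theorem lambdaGradedMainTerm_sqrt (K : LambdaDiag) (X : LambdaCross) (u u' : ℝ → ℂ) (L : LambdaPiece) (s : ℂ)
    (𝔞 : ℝ) : lambdaGradedMainTerm K (sqrtCross X) u u' L s 𝔞
      = ‖s‖ ^ 2 * mainTermForm u u' * 𝔞 + K L + 2 * (s * X u u' L).re * Real.sqrt 𝔞 := by
  simp only [lambdaGradedMainTerm, sqrtCross]
  have : (s * (((Real.sqrt 𝔞 : ℝ) : ℂ) * X u u' L)).re = Real.sqrt 𝔞 * (s * X u u' L).re := by
    rw [mul_left_comm, Complex.re_ofReal_mul]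
  rw [this]
  ring

/-- with NO graded cross the main term is `‖s‖²𝔅(u)𝔞 + K(L)`. [cite: Zhang2022LandauSiegel, §7 (7.2) p.44] -/
theorem lambdaGradedMainTerm_zero (K : LambdaDiag) (u u' : ℝ → ℂ) (L : LambdaPiece) (s : ℂ) (𝔞 : ℝ) :
    lambdaGradedMainTerm K 0 u u' L s 𝔞 = ‖s‖ ^ 2 * mainTermForm u u' * 𝔞 + K L := by
  simp [lambdaGradedMainTerm]

variable (c' : ℝ)

/-- **THE `𝔞`-GRADED Λ-OVERHANG DICTIONARY at fixed amplitude (rows E-070 ⊕ E-071, second statement shape; bare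
`Prop`, NOT asserted — derivation target / OPEN IN PRINT as in Part 3).** For every in-class kinked `u` (`u(1) = 0`),
every Λ-piece `L` overhanging to `θ`, every amplitude `s`, every `ε > 0`, all large `D`, every real primitive `χ`
with (A): `|discMean(s·H_u + H_λ) − M(s,𝔞)·𝔓| ≤ ε·𝔞·𝔓` with `M = lambdaGradedMainTerm K G u u′ L s` at `𝔞 = frakA χ`.
[cite: Zhang2022LandauSiegel, §7 Prop 7.1 (7.2) p.44; §8 (8.23); (2.31)] -/
def ELambdaOverhangGraded (θ : ℝ) (K : LambdaDiag) (G : ℝ → LambdaCross) : Prop :=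
  ∀ (u u' : ℝ → ℂ), KinkedProfile u u' → u 1 = 0 → ∀ (L : LambdaPiece) (v' : ℝ → ℂ), L.Overhang θ v' →
    ∀ (s : ℂ) (ε : ℝ), 0 < ε → ForAllLarge fun D _ χ => AssumptionA D χ →
      |discMean c' χ (gradedDesign χ u L s) - lambdaGradedMainTerm K G u u' L s (frakA χ) * frakP D|
        ≤ ε * frakA χ * frakP D

variable {c'}

/-- **A Λ-design CLOSES AT FLOOR `a` (fixed amplitude):** for some `s` the graded main constant is `≤ −η·𝔞` for EVERY
`𝔞 ≥ a` (`η > 0`). [cite: Zhang2022LandauSiegel, §7 Prop 7.1 (7.2) p.44, (2.31)] -/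
def LambdaGradedClosesAtFloor (K : LambdaDiag) (G : ℝ → LambdaCross) (a : ℝ) (u u' : ℝ → ℂ)
    (L : LambdaPiece) : Prop :=
  ∃ (s : ℂ) (η : ℝ), 0 < η ∧ ∀ 𝔞 : ℝ, a ≤ 𝔞 → lambdaGradedMainTerm K G u u' L s 𝔞 ≤ -η * 𝔞

/-- The Lemma 5.7 floor constant `a₀ = 3/(2e²π²) ≈ 0.02058` of `𝔞` under (A) (`Lemma57.frakA_ge'`).
[cite: Zhang2022LandauSiegel, §2 (after (2.31)), §5 Lemma 5.7] -/
def aZero : ℝ := 3 / (2 * Real.exp 1 ^ 2 * π ^ 2)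

/-- `a₀ > 0`. [cite: Zhang2022LandauSiegel, §5 Lemma 5.7] -/
theorem aZero_pos : 0 < aZero := by unfold aZero; positivity

/-- **THE FLOOR IS EVENTUAL under (A): `𝔞 ≥ a₀`** for every real primitive `χ` to a large modulus with (A) — the
tree's `Lemma57.frakA_ge'` in `ForAllLarge` shape with the explicit constant (`Skeleton.frakALowerBound_holds` hides
it behind `∃ a₀`). [cite: Zhang2022LandauSiegel, §2 (after (2.31)), §5 Lemma 5.7] -/
theorem frakA_floor : ForAllLarge fun D _ χ => AssumptionA D χ → aZero ≤ frakA χ := by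
  obtain ⟨L₀, h⟩ := Lemma57.frakA_ge'
  refine ⟨⌈Real.exp L₀⌉₊, fun D _ χ hD hq hp hA => ?_⟩
  have hD' : L₀ ≤ Real.log D := by
    have h1 : Real.exp L₀ ≤ (D : ℝ) := (Nat.le_ceil _).trans (by exact_mod_cast hD)
    have := Real.log_le_log (Real.exp_pos L₀) h1
    rwa [Real.log_exp] at this
  exact h D χ hp hq.sq_eq_one hD' (le_of_lt hA)

/-- **THE POSITIVITY ENDGAME for graded main terms** (general form of
`eventually_not_assumptionA_of_negative_mainTerm_family`): if under (A), eventually, the discrete mean of SOME family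
of value tables is `≤ M·𝔓 + ε𝔞𝔓` for every `ε > 0` with `M ≤ −η𝔞`, `η > 0`, then — every discrete mean being `≥ 0`
(Prop. 2.2 (i), Lemma 2.3: `weights_nonneg_of`, `discMean_nonneg`) and `𝔞, 𝔓 > 0` — (A) fails for every real
primitive character to every large modulus. [cite: Zhang2022LandauSiegel, §2 p. 6, Lemma 2.3, Prop. 2.2 (i), (2.15)] -/
theorem eventually_not_assumptionA_of_le {c' η : ℝ} (hη : 0 < η)
    {F : ∀ (D : ℕ) [NeZero D] (χ : DirichletCharacter ℂ D), Chr D → ℂ → ℂ}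
    {M : ∀ (D : ℕ) [NeZero D] (_ : DirichletCharacter ℂ D), ℝ}
    (hasymp : ∀ ε : ℝ, 0 < ε → ForAllLarge fun D _ χ => AssumptionA D χ →
      discMean c' χ (F D χ) ≤ M D χ * frakP D + ε * frakA χ * frakP D)
    (hM : ForAllLarge fun D _ χ => AssumptionA D χ → M D χ ≤ -η * frakA χ)
    (h22 : Prop22i) (h23 : Lemma23 c') :
    ∃ D₀ : ℕ, ∀ (D : ℕ) [NeZero D] (χ : DirichletCharacter ℂ D),
      D₀ ≤ D → χ.IsQuadratic → χ.IsPrimitive → ¬ AssumptionA D χ := by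
  have hε : 0 < η / 2 := by linarith
  obtain ⟨D₁, h₁⟩ := (((hasymp (η / 2) hε).and hM).and h22).and h23
  obtain ⟨a₀, ha₀, D₂, h₂⟩ := frakALowerBound_holds
  obtain ⟨D₃, h₃⟩ := frakP_eventually_pos
  refine ⟨max (max D₁ D₂) (max D₃ 3), fun D _ χ hD hq hp hA => ?_⟩
  have hD₁ : D₁ ≤ D := le_trans (le_trans (le_max_left _ _) (le_max_left _ _)) hD
  have hD₂ : D₂ ≤ D := le_trans (le_trans (le_max_right _ _) (le_max_left _ _)) hD
  have hD₃ : D₃ ≤ D := le_trans (le_trans (le_max_left _ _) (le_max_right _ _)) hD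
  have hD3 : 3 ≤ D := le_trans (le_trans (le_max_right _ _) (le_max_right _ _)) hD
  obtain ⟨⟨⟨hmean, hM'⟩, h22'⟩, h23'⟩ := h₁ D χ hD₁ hq hp
  have hmean' := hmean hA
  have hM'' := hM' hA
  have hA0 : 0 < frakA χ := lt_of_lt_of_le ha₀ (h₂ D χ hD₂ hq hp hA)
  have hP0 : 0 < frakP D := h₃ D hD₃
  have hw := weights_nonneg_of hD3 h23' h22'
  have hpos := discMean_nonneg hw (F D χ)
  have hX : 0 < frakA χ * frakP D := mul_pos hA0 hP0
  have : M D χ * frakP D ≤ -η * frakA χ * frakP D := by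
    have := mul_le_mul_of_nonneg_right hM'' hP0.le
    linarith [this]
  nlinarith

variable {θ : ℝ} {K : LambdaDiag} {G : ℝ → LambdaCross} {a : ℝ} {u u' : ℝ → ℂ} {L : LambdaPiece} {v' : ℝ → ℂ}

/-- **S1-Λ POS endgame, graded shape:** the graded dictionary + ONE design closing at a floor `a` that (A) guarantees
eventually + Prop. 2.2 (i) + Lemma 2.3 ⇒ Theorem 1. Nothing asserted. [cite: Zhang2022LandauSiegel, §2 p. 6, §7 Prop 7.1 (7.2)] -/
theorem theorem1_of_eLambdaOverhangGraded (hE : ELambdaOverhangGraded c' θ K G) (hu : KinkedProfile u u')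
    (hu1 : u 1 = 0) (hL : L.Overhang θ v') (hC : LambdaGradedClosesAtFloor K G a u u' L)
    (ha : ForAllLarge fun D _ χ => AssumptionA D χ → a ≤ frakA χ) (h22 : Prop22i) (h23 : Lemma23 c') :
    Theorem1 := by
  obtain ⟨s, η, hη, hMle⟩ := hC
  refine Skeleton.theorem1_of_eventually_not_assumptionA
    (eventually_not_assumptionA_of_le (c' := c') hη
      (F := fun D _ χ => gradedDesign χ u L s)
      (M := fun D _ χ => lambdaGradedMainTerm K G u u' L s (frakA χ)) ?_ ?_ h22 h23)
  · intro ε hε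
    obtain ⟨D₀, h₀⟩ := hE u u' hu hu1 L v' hL s ε hε
    exact ⟨D₀, fun D _ χ hD hq hp hA => by
      have := (abs_le.mp (h₀ D χ hD hq hp hA)).2
      linarith⟩
  · obtain ⟨D₀, h₀⟩ := ha
    exact ⟨D₀, fun D _ χ hD hq hp hA => hMle _ (h₀ D χ hD hq hp hA)⟩

/-- … at the tree's floor `a₀` (`frakA_floor`): no floor hypothesis left. [cite: Zhang2022LandauSiegel, §2 p. 6, §5 Lemma 5.7] -/
theorem theorem1_of_eLambdaOverhangGraded_aZero (hE : ELambdaOverhangGraded c' θ K G) (hu : KinkedProfile u u')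
    (hu1 : u 1 = 0) (hL : L.Overhang θ v') (hC : LambdaGradedClosesAtFloor K G aZero u u' L)
    (h22 : Prop22i) (h23 : Lemma23 c') : Theorem1 :=
  theorem1_of_eLambdaOverhangGraded hE hu hu1 hL hC frakA_floor h22 h23

/-- … and Theorem 2. [cite: Zhang2022LandauSiegel, §1 Theorem 2] -/
theorem theorem2_of_eLambdaOverhangGraded_aZero (hE : ELambdaOverhangGraded c' θ K G) (hu : KinkedProfile u u')
    (hu1 : u 1 = 0) (hL : L.Overhang θ v') (hC : LambdaGradedClosesAtFloor K G aZero u u' L)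
    (h22 : Prop22i) (h23 : Lemma23 c') : Theorem2 :=
  Skeleton.theorem2_of_theorem1 (theorem1_of_eLambdaOverhangGraded_aZero hE hu hu1 hL hC h22 h23)

/-- closing at a floor is monotone in the floor. [cite: Zhang2022LandauSiegel, §7 (7.2) p.44, (2.31)] -/
theorem LambdaGradedClosesAtFloor.mono (h : LambdaGradedClosesAtFloor K G a u u' L) {a' : ℝ} (hle : a ≤ a') :
    LambdaGradedClosesAtFloor K G a' u u' L := by
  obtain ⟨s, η, hη, hs⟩ := h
  exact ⟨s, η, hη, fun 𝔞 h𝔞 => hs 𝔞 (hle.trans h𝔞)⟩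

/-- **«NO by itself», graded shape:** with NO cross (`G = 0`) and `K(L) ≥ 0` no design with `𝔅(u) ≥ 0` closes at
any floor `a > 0`: `M(s,𝔞) = ‖s‖²𝔅(u)𝔞 + K(L) ≥ 0`. [cite: Zhang2022LandauSiegel, §7 Prop 7.1 (7.2) p.44] -/
theorem not_lambdaGradedClosesAtFloor_of_zero (hB : 0 ≤ mainTermForm u u') (hK : 0 ≤ K L) (ha : 0 < a) :
    ¬ LambdaGradedClosesAtFloor K 0 a u u' L := by
  rintro ⟨s, η, hη, hs⟩
  have h := hs a le_rfl
  rw [lambdaGradedMainTerm_zero] at h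
  have h1 : 0 ≤ ‖s‖ ^ 2 * mainTermForm u u' * a := mul_nonneg (mul_nonneg (sq_nonneg _) hB) ha.le
  nlinarith

/-- **Affine grading: the closing criterion at floor `a > 0`.** If for some `s` the `𝔞`-coefficient is NEGATIVE,
`q₁(s) < 0`, and `q₁(s)·a + q₀(s) < 0`, the design closes at floor `a` (with `η = −(q₁ + max(q₀,0)/a)`).
[cite: Zhang2022LandauSiegel, §7 Prop 7.1 (7.2) p.44, (2.31)] -/
theorem lambdaGradedClosesAtFloor_of_affine {X₁ X₀ : LambdaCross} (ha : 0 < a) {s : ℂ}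
    (h1 : gradedCoeffOne X₁ u u' L s < 0)
    (h0 : gradedCoeffOne X₁ u u' L s * a + gradedCoeffZero K X₀ u u' L s < 0) :
    LambdaGradedClosesAtFloor K (affineCross X₁ X₀) a u u' L := by
  set q₁ := gradedCoeffOne X₁ u u' L s with hq₁
  set q₀ := gradedCoeffZero K X₀ u u' L s with hq₀
  refine ⟨s, -(q₁ + max q₀ 0 / a), ?_, fun 𝔞 h𝔞 => ?_⟩
  · have : q₁ * a + max q₀ 0 < 0 := by
      rcases le_total q₀ 0 with hq | hq
      · rw [max_eq_right hq]; nlinarith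
      · rw [max_eq_left hq]; exact h0
    have hdiv : q₁ + max q₀ 0 / a = (q₁ * a + max q₀ 0) / a := by field_simp
    rw [hdiv]
    exact neg_pos.mpr (div_neg_of_neg_of_pos this ha)
  · rw [lambdaGradedMainTerm_affine, neg_neg]
    have hmax : q₀ ≤ max q₀ 0 * (𝔞 / a) := by
      calc q₀ ≤ max q₀ 0 := le_max_left _ _
        _ = max q₀ 0 * 1 := (mul_one _).symm
        _ ≤ max q₀ 0 * (𝔞 / a) :=
            mul_le_mul_of_nonneg_left ((one_le_div ha).mpr h𝔞) (le_max_right _ _)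
    have e : (q₁ + max q₀ 0 / a) * 𝔞 = q₁ * 𝔞 + max q₀ 0 * (𝔞 / a) := by ring
    rw [e]
    linarith [hq₁, hq₀]

/-- **The kernel half of `Creq_offdiag`, graded currency:** on a design with `𝔅(u) > 0`, a two-dipole cross of size
`|X₁(u,L)| ≤ m` has `q₁(s) ≥ −m²/𝔅(u)` at EVERY amplitude — so `q₁ < 0` (necessary for closing at any floor,
`not_lambdaGradedClosesAtFloor_of_coeff_nonneg`) needs `m > 0`, and the floor condition prices `m` against `K(L)`.
(The kernel mode `𝔅(u) = 0` is exempt: `q₁(s) = 2Re(s·X₁(u,L))` is unbounded below as soon as `X₁(u,L) ≠ 0`.)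
[cite: Zhang2022LandauSiegel, §7 Prop 7.1 (7.2) p.44] -/
theorem gradedCoeffOne_ge {X₁ : LambdaCross} {m : ℝ} (hB : 0 < mainTermForm u u') (hm : ‖X₁ u u' L‖ ≤ m)
    (s : ℂ) : -(m ^ 2 / mainTermForm u u') ≤ gradedCoeffOne X₁ u u' L s := by
  unfold gradedCoeffOne
  set b := mainTermForm u u' with hb
  have hr : |(s * X₁ u u' L).re| ≤ ‖s‖ * ‖X₁ u u' L‖ := (Complex.abs_re_le_norm _).trans (norm_mul _ _).le
  have hr' := (abs_le.mp hr).1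
  have hs := norm_nonneg s
  have hx := norm_nonneg (X₁ u u' L)
  have key : -(m ^ 2 / b) ≤ ‖s‖ ^ 2 * b - 2 * (‖s‖ * m) := by
    have e : ‖s‖ ^ 2 * b - 2 * (‖s‖ * m) + m ^ 2 / b = (‖s‖ * b - m) ^ 2 / b := by
      field_simp
      ring
    have : 0 ≤ (‖s‖ * b - m) ^ 2 / b := div_nonneg (sq_nonneg _) hB.le
    linarith
  have h2 : ‖s‖ * ‖X₁ u u' L‖ ≤ ‖s‖ * m := mul_le_mul_of_nonneg_left hm hs
  linarith

/-- `q₁(s) ≥ 0` and `q₀(s) ≥ 0` at every amplitude ⇒ no closing at a positive floor (affine grading).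
[cite: Zhang2022LandauSiegel, §7 Prop 7.1 (7.2) p.44] -/
theorem not_lambdaGradedClosesAtFloor_of_coeff_nonneg {X₁ X₀ : LambdaCross} (ha : 0 < a)
    (h1 : ∀ s : ℂ, 0 ≤ gradedCoeffOne X₁ u u' L s) (h0 : ∀ s : ℂ, 0 ≤ gradedCoeffZero K X₀ u u' L s) :
    ¬ LambdaGradedClosesAtFloor K (affineCross X₁ X₀) a u u' L := by
  rintro ⟨s, η, hη, hs⟩
  have h := hs a le_rfl
  rw [lambdaGradedMainTerm_affine] at h
  have := mul_nonneg (h1 s) ha.le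
  nlinarith [h0 s]

/-- **Why Part 3 balances the amplitude: a ONE-DIPOLE cross never closes at FIXED amplitude.** With `G 𝔞 = √𝔞•X`,
`𝔅(u) > 0` and `K(L) ≥ 0`, `M(s,𝔞) = ‖s‖²𝔅(u)𝔞 + K + 2Re(sX)√𝔞 ≥ K − (Re(sX))²/(‖s‖²𝔅(u))`, bounded below
uniformly in `𝔞` — incompatible with `M ≤ −η𝔞` for all large `𝔞`. [cite: Zhang2022LandauSiegel, §7 Prop 7.1 (7.2) p.44, (2.31)] -/
theorem not_lambdaGradedClosesAtFloor_of_sqrt {X : LambdaCross} (hB : 0 < mainTermForm u u') (hK : 0 ≤ K L)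
    (ha : 0 < a) : ¬ LambdaGradedClosesAtFloor K (sqrtCross X) a u u' L := by
  rintro ⟨s, η, hη, hs⟩
  set b := mainTermForm u u' with hb
  set r := (s * X u u' L).re with hr
  -- choose `𝔞` large: beyond the floor, beyond where `−η𝔞` beats the uniform lower bound
  by_cases hs0 : s = 0
  · -- `s = 0`: `M = K ≥ 0 > −η·a`
    have h := hs a le_rfl
    rw [lambdaGradedMainTerm_sqrt, hs0] at h
    simp at h
    nlinarith
  · have hsn : 0 < ‖s‖ ^ 2 := by positivity
    have hsb : 0 < ‖s‖ ^ 2 * b := mul_pos hsn hB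
    -- uniform lower bound `M(s,𝔞) ≥ K − r²/(‖s‖² b)` for `𝔞 ≥ 0`
    have lower : ∀ 𝔞 : ℝ, 0 ≤ 𝔞 → K L - r ^ 2 / (‖s‖ ^ 2 * b) ≤ lambdaGradedMainTerm K (sqrtCross X) u u' L s 𝔞 := by
      intro 𝔞 h𝔞
      rw [lambdaGradedMainTerm_sqrt]
      set t := Real.sqrt 𝔞 with ht
      have ht2 : t ^ 2 = 𝔞 := by rw [ht, Real.sq_sqrt h𝔞]
      have e : ‖s‖ ^ 2 * b * 𝔞 + K L + 2 * r * t - (K L - r ^ 2 / (‖s‖ ^ 2 * b))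
          = (‖s‖ ^ 2 * b * t + r) ^ 2 / (‖s‖ ^ 2 * b) := by
        rw [← ht2]; field_simp; ring
      have : 0 ≤ (‖s‖ ^ 2 * b * t + r) ^ 2 / (‖s‖ ^ 2 * b) := div_nonneg (sq_nonneg _) hsb.le
      linarith
    -- pick `𝔞 = max a A` with `η·A > r²/(‖s‖² b) − K + 1`
    set A : ℝ := (r ^ 2 / (‖s‖ ^ 2 * b) - K L + 1) / η with hA
    have hA' : η * A = r ^ 2 / (‖s‖ ^ 2 * b) - K L + 1 := by rw [hA]; field_simp
    have h𝔞 := hs (max a A) (le_max_left _ _)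
    have hlow := lower (max a A) (ha.le.trans (le_max_left _ _))
    have hmax : A ≤ max a A := le_max_right _ _
    have : -η * max a A ≤ -η * A := by nlinarith
    nlinarith

end Graded

/-! ### Part 7 — the `H¹`-weighted diagonal functional (planner's request; weights = derivation items) -/

section DiagH1

/-- **`K_{w₀,w₁}(L) = ∫₁^θ (w₀(z)‖prof(z)‖² + w₁(z)‖prof′(z)‖²) dz`** — the `H¹`-weighted diagonal of the Λ-overhang
(`prof′ = deriv prof`, which agrees a.e. with any marked right derivative of a piecewise-`C¹` profile); both weights
are derivation items of row E-070 (HEURISTIC until derived; `w₁ = 0` recovers `lambdaOverhangDiag`).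
[cite: Zhang2022LandauSiegel, §7 Prop 7.1 (7.2) p.44] -/
def lambdaOverhangDiagH1 (θ : ℝ) (w₀ w₁ : ℝ → ℝ) : LambdaDiag := fun L =>
  ∫ z in (1:ℝ)..θ, (w₀ z * ‖L.prof z‖ ^ 2 + w₁ z * ‖deriv L.prof z‖ ^ 2)

/-- sign `+` for non-negative weights on `[1,θ]`, `θ ≥ 1`. [cite: Zhang2022LandauSiegel, §7 Prop 7.1 (7.2) p.44] -/
theorem lambdaOverhangDiagH1_nonneg {θ : ℝ} (hθ : 1 ≤ θ) {w₀ w₁ : ℝ → ℝ} (hw₀ : ∀ z ∈ Icc 1 θ, 0 ≤ w₀ z)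
    (hw₁ : ∀ z ∈ Icc 1 θ, 0 ≤ w₁ z) (L : LambdaPiece) : 0 ≤ lambdaOverhangDiagH1 θ w₀ w₁ L :=
  intervalIntegral.integral_nonneg hθ fun z hz =>
    add_nonneg (mul_nonneg (hw₀ z hz) (sq_nonneg _)) (mul_nonneg (hw₁ z hz) (sq_nonneg _))

/-- the `H¹`-weighted candidate with non-negative weights satisfies the class sign claim.
[cite: Zhang2022LandauSiegel, §7 Prop 7.1 (7.2) p.44] -/
theorem lambdaOverhangDiagNonneg_H1 {θ : ℝ} {w₀ w₁ : ℝ → ℝ} (hw₀ : ∀ z ∈ Icc 1 θ, 0 ≤ w₀ z)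
    (hw₁ : ∀ z ∈ Icc 1 θ, 0 ≤ w₁ z) : LambdaOverhangDiagNonneg θ (lambdaOverhangDiagH1 θ w₀ w₁) :=
  fun L _ hL => lambdaOverhangDiagH1_nonneg hL.one_lt.le hw₀ hw₁ L

/-- with `w₁ = 0` the `H¹`-weighted functional is the plain one. [cite: Zhang2022LandauSiegel, §7 (7.2) p.44] -/
theorem lambdaOverhangDiagH1_zero_right (θ : ℝ) (w₀ : ℝ → ℝ) :
    lambdaOverhangDiagH1 θ w₀ 0 = lambdaOverhangDiag θ w₀ := by
  funext L
  simp [lambdaOverhangDiagH1, lambdaOverhangDiag]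

end DiagH1

end KnifeEdge

end Literature.NumberTheory.LFunctions.Zhang2022
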